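import Mathlib
import Summits.CriticalPhenomena.PercolationContinuityZ3.Theorems.PercNearOneGluingNoHeavyLowerTailBlockStarGluing
import Summits.CriticalPhenomena.PercolationContinuityZ3.Theorems.PercNearOneGluingAdditiveGluingPartial
import HarnessLib

/-!
# Crux `PercNearOneGluing.NoHeavyLowerTail` (stmt-CriticalPhenomena-4575), line `bhk-superadditivity-thinning` —
# stub `blockOnePrivateGluing`: additive gluing for a glued block with one private neighbour

Lead prover-line-stmt-CriticalPhenomena-4575-c5-0, 2026-08-16.  Proves exactly the registered stub signature
`blockOnePrivateGluing`; lands with `--supports stmt-CriticalPhenomena-4575`.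

## Content

Finite weighted graph on `Fin n`, weights `w : Sym2 (Fin n) → unitInterval`, an OBSERVER BLOCK `O`
contracted (`μ = prodBernoulli (glue w O)`, `glue w O = fun e => if (∀ y ∈ e, y ∈ O) ∧ ¬ e.IsDiag then 1
else w e`, weight `1` on the non-loop pairs inside `O`), a relay set `A` disjoint from `O`, a target
`b ∈ A`, and ONE PRIVATE vertex `x ∉ O ∪ A`: every positive-weight pair from `O` to a non-relay outside
`O` ends at `x` (`∀ o ∈ O, ∀ y ∉ O ∪ A ∪ {x}, w s(o, y) = 0`), and every positive-weight pair from `x`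
ends in `O ∪ A` (`∀ y ∉ O ∪ A ∪ {x}, w s(x, y) = 0`).  If every relay is reliable, `μ(a ↔ b) ≥ 1 − t`
for all `a ∈ A` (`0 ≤ t`), then

  `μ(O ↔ A) − t ≤ μ(O ↔ b)`.

This is Kozma–Nitzan (arXiv:2401.12397) Thm 5 (p. 13) in additive, block form; the lead uses it (with
`O = {o}` and `O = {o, x}`) to get a linear gluing rate for observers with two private neighbours.

## Proof

The proof of `blockStarGluing` (file `…NoHeavyLowerTailBlockStarGluing.lean`) with one difference.  Pick
the relay `a₀ ∈ A` minimising `P_k(· ↔ b)` over `A`, `k = kill w O = fun e => if (∃ y ∈ e, y ∈ O) then 0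
else w e`.  One application of the σ-recursion engine `stub_sigmaRecursion` at the block `O` (geometry
`stub_sigmaGeometry`, law `stub_sigmaLaw`) gives `μ(O ↔ A) − μ(O ↔ b) ≤ 1 − μ(a₀ ↔ b)`, provided (i) on
every positive layer `S` meeting `A` at `v` with `b ∉ S` the Lemma-5 comparison holds — `stub_gluingLemma5`
for the weights `k`, fed with the minimality `P_k(a₀ ↔ b) ≤ P_k(v ↔ b)`; and (ii) the designated
inequality on every non-empty positive layer `S` avoiding `A ∪ {b}`:
`P'(S ↔ A) − P'(S ↔ b) ≤ 1 − P'(a₀ ↔ b)` with `P' = prodBernoulli (glue k S)`.  A vertex `y` of such a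
layer has `y ∉ O`, `y ∉ A` and `w s(o, y) ≠ 0` for some `o ∈ O`, so `y = x` by the first isolation
hypothesis: `S = {x}`.  Contracting a singleton changes nothing (`agPartial_glue_singleton`: `glue k {x} = k`),
and the inequality is `blockStarGluing` for the block `{x}` under the weights `k` with
`t' = 1 − P_k(a₀ ↔ b) ≥ 0`: `{x}` is star-attached under `k` (a pair `s(x, y)` with `y ∈ O` is killed, and
for `y ∉ O ∪ A ∪ {x}` its weight is `w s(x, y) = 0` by the second isolation hypothesis), and every relay
`a ∈ A` has `P_k(a ↔ b) ≥ P_k(a₀ ↔ b) = 1 − t'` by minimality.  Finally `1 − μ(a₀ ↔ b) ≤ t` by the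
relay hypothesis at `a₀`.
-/

namespace Summit.CriticalPhenomena.PercolationContinuityZ3.Theorems

open MeasureTheory Set
open Literature.Probability.LatticeModels (prodBernoulli)
open Literature.Probability.Percolation (BondConfig openConn)

noncomputable section
open Classical

/-- **Additive gluing for a glued block with one private neighbour** (Kozma–Nitzan arXiv:2401.12397
Thm 5, additive block form; registered stub `blockOnePrivateGluing` of crux stmt-CriticalPhenomena-4575,
line `bhk-superadditivity-thinning`).  With the block `O` contracted (`glue w O`), `A` disjoint from `O`,
`b ∈ A`, a private vertex `x ∉ O ∪ A` such that every positive-weight pair from `O` to a non-relay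
outside `O` ends at `x` and every positive-weight pair from `x` ends in `O ∪ A`, `0 ≤ t` and
`μ(a ↔ b) ≥ 1 − t` for all `a ∈ A`:  `μ(O ↔ A) − t ≤ μ(O ↔ b)`.  Proof: the σ-recursion engine at the
block `O` with the relay minimising `P_{kill w O}(· ↔ b)`; layers meeting `A` are handled by KN Lemma 5,
and the only non-empty positive layer avoiding `A` is `{x}`, for which the designated inequality is
`blockStarGluing` for the block `{x}` under the killed weights. -/
theorem blockOnePrivateGluing : ∀ (n : ℕ) (w : Sym2 (Fin n) → unitInterval) (O A : Finset (Fin n)) (x b : Fin n) (t : ℝ), Disjoint O A → b ∈ A → x ∉ O → x ∉ A → (∀ o ∈ O, ∀ y : Fin n, y ∉ O → y ∉ A → y ≠ x → w s(o, y) = 0) → (∀ y : Fin n, y ∉ O → y ∉ A → y ≠ x → w s(x, y) = 0) → 0 ≤ t → (∀ a ∈ A, 1 - t ≤ (Literature.Probability.LatticeModels.prodBernoulli (fun e : Sym2 (Fin n) => if (∀ y ∈ e, y ∈ O) ∧ ¬ e.IsDiag then 1 else w e)).real (Literature.Probability.Percolation.openConn a b)) → (Literature.Probability.LatticeModels.prodBernoulli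 (fun e : Sym2 (Fin n) => if (∀ y ∈ e, y ∈ O) ∧ ¬ e.IsDiag then 1 else w e)).real (⋃ o ∈ O, ⋃ y ∈ A, Literature.Probability.Percolation.openConn o y) - t ≤ (Literature.Probability.LatticeModels.prodBernoulli (fun e : Sym2 (Fin n) => if (∀ y ∈ e, y ∈ O) ∧ ¬ e.IsDiag then 1 else w e)).real (⋃ o ∈ O, Literature.Probability.Percolation.openConn o b) := by
  intro n w O A x b t hOA hbA hxO hxA hisoO hisox _ht hrel
  have hbO : b ∉ O := fun h => Finset.disjoint_left.1 hOA h hbA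
  -- the designated relay: minimise `P_{kill w O}(y ↔ b)` over `y ∈ A`
  obtain ⟨a₀, ha₀, hmin⟩ := Finset.exists_min_image A
    (fun y => (prodBernoulli (fun e : Sym2 (Fin n) => if (∃ y ∈ e, y ∈ O) then 0 else w e)).real
      (openConn y b)) ⟨b, hbA⟩
  -- minimality, in β-reduced form
  have hmin' : ∀ a ∈ A,
      (prodBernoulli (fun e : Sym2 (Fin n) => if (∃ y ∈ e, y ∈ O) then 0 else w e)).real
          (openConn a₀ b) ≤
        (prodBernoulli (fun e : Sym2 (Fin n) => if (∃ y ∈ e, y ∈ O) then 0 else w e)).real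
          (openConn a b) := fun a ha => hmin a ha
  -- the σ-recursion engine at the block `O`
  have key := stub_sigmaRecursion n w O A b a₀ hOA hbO ha₀ (stub_sigmaGeometry n O)
    (stub_sigmaLaw n w O)
    (fun S _ hSA hbS => by
      -- a positive layer meeting `A` at `v`: KN Lemma 5 for the weights `kill w O`
      obtain ⟨v, hv⟩ := hSA
      rw [Finset.mem_inter] at hv
      exact stub_gluingLemma5 n (fun e : Sym2 (Fin n) => if (∃ y ∈ e, y ∈ O) then 0 else w e)
        S a₀ v b hv.1 hbS (hmin v hv.2))
    (fun S hS hSne hSA _ => by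
      -- an `A`-avoiding non-empty positive layer is `{x}` (first isolation hypothesis)
      have hall : ∀ y ∈ S, y = x := by
        intro y hy
        by_contra hne
        obtain ⟨hyO, o, ho, hw⟩ := hS y hy
        exact hw (hisoO o ho y hyO (fun h => Finset.disjoint_left.1 hSA hy h) hne)
      have hxS : x ∈ S := by
        obtain ⟨y, hy⟩ := hSne
        exact hall y hy ▸ hy
      have hSx : S = {x} := Finset.eq_singleton_iff_unique_mem.2 ⟨hxS, hall⟩
      subst hSx
      -- contracting the singleton `{x}` on top of the killed weights changes nothing
      have hglue : (fun e : Sym2 (Fin n) =>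
          if (∀ y ∈ e, y ∈ ({x} : Finset (Fin n))) ∧ ¬ e.IsDiag then 1 else
            if (∃ y ∈ e, y ∈ O) then 0 else w e) =
          (fun e : Sym2 (Fin n) => if (∃ y ∈ e, y ∈ O) then 0 else w e) :=
        agPartial_glue_singleton (fun e : Sym2 (Fin n) => if (∃ y ∈ e, y ∈ O) then 0 else w e) x
      -- KN Thm 4 (block form) for the block `{x}` under the killed weights, `t' = 1 − P_k(a₀ ↔ b)`
      have hbs := blockStarGluing n (fun e : Sym2 (Fin n) => if (∃ y ∈ e, y ∈ O) then 0 else w e)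
        {x} A b
        (1 - (prodBernoulli (fun e : Sym2 (Fin n) => if (∃ y ∈ e, y ∈ O) then 0 else w e)).real
          (openConn a₀ b))
        (Finset.disjoint_singleton_left.2 hxA) hbA
        (fun x₁ hx₁ y hyx hyA => by
          -- star-attachment of `{x}` under the killed weights (second isolation hypothesis)
          rw [Finset.mem_singleton] at hx₁ hyx
          rw [hx₁]
          show (if (∃ z ∈ s(x, y), z ∈ O) then (0 : unitInterval) else w s(x, y)) = 0
          split_ifs with h
          · rfl
          · exact hisox y (fun hyO => h ⟨y, Sym2.mem_mk_right x y, hyO⟩) hyA hyx)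
        (sub_nonneg.2 measureReal_le_one)
        (fun a ha => by
          -- the relays: minimality of `a₀`
          rw [hglue, sub_sub_cancel]
          exact hmin' a ha)
      rw [hglue] at hbs ⊢
      linarith)
  -- the relay hypothesis at `a₀`
  have hr := hrel a₀ ha₀
  linarith

end

end Summit.CriticalPhenomena.PercolationContinuityZ3.Theorems
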